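import Mathlib
import Literature.NumberTheory.LFunctions.RiemannXi
import Literature.NumberTheory.LFunctions.RiemannXiLogDeriv
import Summits.RiemannHypothesis.RiemannHypothesis.Theorems.DeBrangesSuzukiDoorDefs

/-!
# SuzukiWeightedDoor — definitions and the RH-FREE rung leaf `GrowthAbscissaIdentity` (column DBR, round 3; defs only)

RH-FREE objects over the cell's single Suzuki operator (`SuzukiDoor.limKernel θ = K_θ`, `SuzukiDoor.limWindowAvg θ = W_θ`,
[Su20] arXiv:1907.07302 (1.9)–(1.10)):
* `WeightedWitness θ η`  — the weighted window function `x ↦ e^{−ηx} W_θ(x)` is in `L²(ℝ)`  (η = 0: the residual `DoorWitness`'s witness);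
* `XiZeroFreeAbove σ₀`   — `ξ` has no zero with `Re s > σ₀` (a THEOREM for `σ₀ ≥ 1`; quasi-RH(σ₀) for `σ₀ ∈ [1/2,1)`; RH iff `σ₀ = 1/2`);
* `growthAbscissa θ`, `xiZeroFreeAbscissa` — the two abscissae as real numbers (infima); module 6 proves `growthAbscissa θ = xiZeroFreeAbscissa − 1/2`;
* `GrowthAbscissaIdentity` — THE RUNG LEAF (RH-FREE, class rung, never summit credit): for every `θ > 10` and `η ≥ 0`,
  (door) `WeightedWitness θ η → XiZeroFreeAbove (1/2 + η)` and (converse) `XiZeroFreeAbove σ₀ → WeightedWitness θ η` whenever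
  `1/2 ≤ σ₀ < 1/2 + η`.  Informally: the `L²`-growth abscissa of `W_θ` equals `max(sup Re ρ − 1/2, 0)` — an identity between two
  RH-free quantities; RH is the value `0` of either side and is NOT asserted.  Nearest print: [Su21] arXiv:1606.05726 Thm 9.1
  (the (ω,ν)-family quasi-RH criterion); the single-operator weighted form is the cell's.
Labels: every statement here is RH-FREE (a definition or an identity between RH-free quantities); nothing bears on the truth of RH.
-/

noncomputable section

-- D-0017: `Summit.<S>.<S>.…` is the designed namespace of a single-problem summit.
set_option linter.dupNamespace false

open MeasureTheory

namespace Summit.RiemannHypothesis.RiemannHypothesis.Theorems.SuzukiWeightedDoor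

open Literature.NumberTheory.LFunctions

/-- RH-FREE object: the weighted single-operator witness at height `η` — `x ↦ e^{−ηx} W_θ(x) ∈ L²(ℝ)`,
`W_θ = SuzukiDoor.limWindowAvg θ` (the unit-window average of `K_θ`). -/
def WeightedWitness (θ η : ℝ) : Prop :=
  MemLp (fun x : ℝ => Real.exp (-η * x) * SuzukiDoor.limWindowAvg θ x) 2 volume

/-- RH-FREE object: `ξ` (`Literature.NumberTheory.LFunctions.riemannXi`) has no zero in the open half-plane `Re s > σ₀`. -/
def XiZeroFreeAbove (σ₀ : ℝ) : Prop :=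
  ∀ s : ℂ, σ₀ < s.re → riemannXi s ≠ 0

/-- **RUNG LEAF (RH-FREE, class rung — never summit credit): the growth-abscissa identity.**  For every `θ > 10` and every
`η ≥ 0`: a weighted witness at height `η` excludes zeros of `ξ` with `Re s > 1/2 + η` (the shifted door), and a zero-free
half-plane `Re s > σ₀` with `1/2 ≤ σ₀ < 1/2 + η` gives the weighted witness at height `η` (the converse). -/
def GrowthAbscissaIdentity : Prop :=
  ∀ θ : ℝ, 10 < θ → ∀ η : ℝ, 0 ≤ η →
    (WeightedWitness θ η → XiZeroFreeAbove (1 / 2 + η)) ∧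
      (∀ σ₀ : ℝ, 1 / 2 ≤ σ₀ → σ₀ < 1 / 2 + η → XiZeroFreeAbove σ₀ → WeightedWitness θ η)

/-- RH-FREE quantity: the `L²`-GROWTH ABSCISSA of `W_θ` — `inf {η ≥ 0 : e^{−η·} W_θ ∈ L²(ℝ)}`. -/
def growthAbscissa (θ : ℝ) : ℝ :=
  sInf {η : ℝ | 0 ≤ η ∧ WeightedWitness θ η}

/-- RH-FREE quantity: the (clamped) ZERO-FREE ABSCISSA of `ξ` — `inf {σ₀ ≥ 1/2 : ξ ≠ 0 on Re s > σ₀}` (`= max(sup Re ρ, 1/2)`;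
a real number in `[1/2, 1]` whatever the truth of RH). -/
def xiZeroFreeAbscissa : ℝ :=
  sInf {σ₀ : ℝ | 1 / 2 ≤ σ₀ ∧ XiZeroFreeAbove σ₀}

/-- RH-FREE KNOWN (tree, PNT line): `ξ ≠ 0` on `Re s ≥ 1`, hence `XiZeroFreeAbove 1`. -/
theorem xiZeroFreeAbove_one : XiZeroFreeAbove 1 := fun _ hs =>
  riemannXi_ne_zero_of_one_le_re hs.le

/-- Monotonicity: a zero-free half-plane contains every smaller one. -/
theorem XiZeroFreeAbove.mono {σ₀ σ₁ : ℝ} (h : XiZeroFreeAbove σ₀) (hle : σ₀ ≤ σ₁) : XiZeroFreeAbove σ₁ :=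
  fun s hs => h s (lt_of_le_of_lt hle hs)

end Summit.RiemannHypothesis.RiemannHypothesis.Theorems.SuzukiWeightedDoor

end
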